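import Literature.Analysis.FluidPDE.Seregin2020SwirlEnergyInequality
import Literature.Analysis.FluidPDE.AxisymRadialQuotient
import HarnessLib

/-!
# SwirlFreeBudget, crux K-18.1 `EtaMoserBound`, step A.2: the localised `L^{2m}` energy identity
# for `η = ω_θ/r`, slice by slice and integrated in time (seat nsreg-p4 g13)

Support file for the DORMANT route `SwirlThreshold` (crux stmt-NavierStokesRegularity-2002) and
planner nsreg-p2's ROUND-18 Appendix A (`R18-APPENDIX-EtaMoser.md`, §A.2).  The `η`-twin of the
tree's energy identity for the swirl `Γ` (`Literature.Analysis.FluidPDE.Seregin2020.swirl_energy_slice_identity`,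
`…swirl_energy_identity`, proof of Seregin 2020 Thm 2.1 / Lei–Zhang 2011 (2.2)–(2.3)), for a
scalar family `f τ` (in the application `η = ω_θ/r` of the cut-off Seregin–Zajączkowski
representative `W`, sibling `…SwirlFreeBudgetEtaEquation`) which is smooth on ALL of `ℝ³` and
solves `∂ₜf = Δf − Df[W] + 2 radDerivQuot f` (KNSS 2009 (5.10)) at the points of an open set `U`
on which `W` is divergence free.  Differences from the swirl case: the slices are globally smooth
(so Green's identity and the transport integration by parts are the tree's global
`integral_laplacian_mul_deriv_comp_mul_sq` (Lei–Zhang 2011 proofs file) and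
`integral_inner_gradient_eq_zero_of_divergence_eq_zero`), and the axis term
`+2∫ H'(f) radDerivQuot f Θ²` is KEPT as it is (its sign is the sibling `…SwirlFreeBudgetEtaAxisTerm`;
for the swirl the drift `−(2/r)∂ᵣ` was moved onto the cut-off off the axis instead).

* `eta_energy_slice_identity` — at a fixed time, for `F ∈ C²(ℝ³)`, `w ∈ C¹(ℝ³; ℝ³)` divergence
  free on an open `U ⊇ tsupport Θ`, `H ∈ C²`, `Θ ∈ C¹_c`:
  `∫ H'(F)(ΔF − DF[w] + 2 q_F)Θ² = −∫(H''(F)|∇F|²Θ² + H'(F)⟪∇F,∇Θ²⟫) + ∫ H(F)⟪w,∇Θ²⟫ + 2∫ H'(F) q_F Θ²`;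
* `continuousOn_eta_sliceFunctionals` — continuity in time of the slice functionals
  `M, G_H, T₁, P, T_W, T_a`;
* `eta_energy_identity` — integrated in time against `χ ∈ C¹` on `[t₁, t₂] ⊆ ]lo, hi[`:
  `∫ (H(f(t₂))χ(t₂) − H(f(t₁))χ(t₁))Θ² = ∫_{t₁}^{t₂} (χ[−∫(H''|∇f|²Θ² + H'⟪∇f,∇Θ²⟫) + ∫H⟪W,∇Θ²⟫ + 2∫H' q_f Θ²] + χ'∫HΘ²) ds`
  (the integrated chain rule `integral_comp_mul_sub_eq_integral_integral_ae` on the integrated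
  equation, then the slice identity).

WHAT THIS IS NOT: not NS regularity — an identity for the smooth swirl-free class; `EtaMoserBound`
stays OPEN here; no crux claim.
-/

-- the problem directory repeats the summit name (D-0017); core's `dupNamespace` linter fires
set_option linter.dupNamespace false

namespace Summit.NavierStokesRegularity.NavierStokesRegularity.Theorems.SwirlFreeBudget

open MeasureTheory Set Filter Topology Metric Function intervalIntegral
open scoped RealInnerProductSpace Laplacian ContDiff
open Literature.Analysis Literature.Analysis.FluidPDE Literature.Analysis.FluidPDE.Seregin2020

noncomputable section

/-! ### The slice identity -/

/-- **The slice identity of the energy method for `η`** (memo A.2, the three integrations by parts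
at a fixed time; the `η`-twin of `Seregin2020.swirl_energy_slice_identity`).  For `F ∈ C²(ℝ³)`,
a field `w ∈ C¹(ℝ³)` divergence free on an open `U`, a profile `H ∈ C²` and a cut-off `Θ ∈ C¹_c`
with `tsupport Θ ⊆ U`:
`∫ H'(F)(ΔF − DF[w] + 2 q_F)Θ² = −∫(H''(F)|∇F|²Θ² + H'(F)⟪∇F,∇Θ²⟫) + ∫ H(F)⟪w,∇Θ²⟫ + 2∫ H'(F) q_F Θ²`
(`q_F = radDerivQuot F`; Green's identity; `div w = 0` on `U`). -/
theorem eta_energy_slice_identity {F : EuclideanSpace ℝ (Fin 3) → ℝ} (hF : ContDiff ℝ 2 F)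
    {w : EuclideanSpace ℝ (Fin 3) → EuclideanSpace ℝ (Fin 3)} (hw : ContDiff ℝ 1 w)
    {U : Set (EuclideanSpace ℝ (Fin 3))} (hdiv : ∀ x ∈ U, VectorCalculus.divergence w x = 0)
    {H : ℝ → ℝ} (hH : ContDiff ℝ 2 H)
    {Θ : EuclideanSpace ℝ (Fin 3) → ℝ} (hΘ : ContDiff ℝ 1 Θ) (hΘc : HasCompactSupport Θ)
    (hΘU : tsupport Θ ⊆ U) :
    ∫ x, deriv H (F x) * ((Δ F) x - fderiv ℝ F x (w x) + 2 * radDerivQuot F x) * Θ x ^ 2 =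
      -(∫ x, (deriv (deriv H) (F x) * ‖gradient F x‖ ^ 2 * Θ x ^ 2 +
          deriv H (F x) * ⟪gradient F x, gradient (fun y => Θ y ^ 2) x⟫)) +
      (∫ x, H (F x) * ⟪w x, gradient (fun y => Θ y ^ 2) x⟫) +
      2 * ∫ x, deriv H (F x) * radDerivQuot F x * Θ x ^ 2 := by
  set K : Set (EuclideanSpace ℝ (Fin 3)) := tsupport Θ with hKdef
  have hK : IsCompact K := hΘc
  have hF1 : ContDiff ℝ 1 F := hF.of_le one_le_two
  have hH1 : ContDiff ℝ 1 H := hH.of_le one_le_two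
  have hH' : ContDiff ℝ 1 (deriv H) := by
    have h2 : ContDiff ℝ (1 + 1) H := by rw [one_add_one_eq_two]; exact hH
    exact h2.deriv'
  -- continuity of the building blocks
  have cF : Continuous F := hF.continuous
  have cHF : Continuous fun x => H (F x) := hH.continuous.comp cF
  have cH'F : Continuous fun x => deriv H (F x) := hH'.continuous.comp cF
  have cΔF : Continuous (Δ F) :=
    (continuousOn_laplacian_of_contDiffOn isOpen_univ hF.contDiffOn).comp_continuous continuous_id
      (fun _ => mem_univ _)
  have cgradF : Continuous (gradient F) := continuous_gradient_of_contDiff hF1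
  have cfderivF : Continuous (fderiv ℝ F) := hF1.continuous_fderiv one_ne_zero
  have cq : Continuous (radDerivQuot F) := continuous_radDerivQuot hF
  have cw : Continuous w := hw.continuous
  have cΘ : Continuous Θ := hΘ.continuous
  have cΘ2 : Continuous fun y => Θ y ^ 2 := cΘ.pow 2
  have hΘ2 : ContDiff ℝ 1 fun y => Θ y ^ 2 := hΘ.pow 2
  have cgradΘ2 : Continuous (gradient fun y => Θ y ^ 2) := continuous_gradient_of_contDiff hΘ2
  -- vanishing off `K`
  have hΘ0 : ∀ x, x ∉ K → Θ x = 0 := fun x hx => image_eq_zero_of_notMem_tsupport hx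
  have hgΘ0 : ∀ x, x ∉ K → gradient (fun y => Θ y ^ 2) x = 0 := fun x hx => gradient_sq_eq_zero_of_notMem hx
  -- the integrands and their integrability
  set P₁ : EuclideanSpace ℝ (Fin 3) → ℝ := fun x => deriv H (F x) * Θ x ^ 2 * (Δ F) x with hP₁
  set P₂ : EuclideanSpace ℝ (Fin 3) → ℝ := fun x => ⟪w x, gradient F x⟫ * (deriv H (F x) * Θ x ^ 2) with hP₂
  set P₃ : EuclideanSpace ℝ (Fin 3) → ℝ := fun x => deriv H (F x) * radDerivQuot F x * Θ x ^ 2 with hP₃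
  set P₄ : EuclideanSpace ℝ (Fin 3) → ℝ := fun x => H (F x) * ⟪w x, gradient (fun y => Θ y ^ 2) x⟫ with hP₄
  have hsupp : ∀ {g : EuclideanSpace ℝ (Fin 3) → ℝ}, Continuous g → (∀ x, x ∉ K → g x = 0) → Integrable g :=
    fun hg h0 => hg.integrable_of_hasCompactSupport (HasCompactSupport.intro hK h0)
  have iP₁ : Integrable P₁ := hsupp ((cH'F.mul cΘ2).mul cΔF) (fun x hx => by simp [hP₁, hΘ0 x hx])
  have iP₂ : Integrable P₂ :=
    hsupp ((cw.inner cgradF).mul (cH'F.mul cΘ2)) (fun x hx => by simp [hP₂, hΘ0 x hx])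
  have iP₃ : Integrable P₃ := hsupp ((cH'F.mul cq).mul cΘ2) (fun x hx => by simp [hP₃, hΘ0 x hx])
  have iP₄ : Integrable P₄ := hsupp (cHF.mul (cw.inner cgradΘ2)) (fun x hx => by
    show H (F x) * ⟪w x, gradient (fun y => Θ y ^ 2) x⟫ = 0
    rw [hgΘ0 x hx, inner_zero_right, mul_zero])
  -- (1) the viscous term: Green's identity
  have e₁ : ∫ x, P₁ x = -∫ x, (deriv (deriv H) (F x) * ‖gradient F x‖ ^ 2 * Θ x ^ 2 +
      deriv H (F x) * ⟪gradient F x, gradient (fun y => Θ y ^ 2) x⟫) :=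
    integral_laplacian_mul_deriv_comp_mul_sq hF hH hΘ hΘc
  -- the test function `ψ = Θ² H(F)` of the transport term
  set ψ : EuclideanSpace ℝ (Fin 3) → ℝ := fun x => Θ x ^ 2 * H (F x) with hψ
  have hψC : ContDiff ℝ 1 ψ := hΘ2.mul (hH1.comp hF1)
  have hψK : tsupport ψ ⊆ K := tsupport_mul_subset_left.trans tsupport_mul_subset_right
  have hψc : HasCompactSupport ψ := hK.of_isClosed_subset (isClosed_tsupport _) hψK
  have hgradψ : ∀ x, gradient ψ x =
      (Θ x ^ 2 * deriv H (F x)) • gradient F x + H (F x) • gradient (fun y => Θ y ^ 2) x := by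
    intro x
    have hFd : DifferentiableAt ℝ F x := (hF1.differentiable one_ne_zero) x
    have hHF : DifferentiableAt ℝ (fun y => H (F y)) x := ((hH.differentiable two_ne_zero) (F x)).comp x hFd
    have hΘ2d : DifferentiableAt ℝ (fun y => Θ y ^ 2) x := (hΘ2.differentiable one_ne_zero) x
    rw [hψ, gradient_mul_apply' hΘ2d hHF,
      gradient_comp_apply ((hH.differentiable two_ne_zero) (F x)) hFd, smul_smul, add_comm]
  -- (2) the transport term
  have e₂ : ∫ x, P₂ x = -∫ x, P₄ x := by
    have hz := integral_inner_gradient_eq_zero_of_divergence_eq_zero hw hψC hψc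
      (fun x hx => hdiv x (hΘU (hψK hx)))
    have hsplit : ∫ x, ⟪w x, gradient ψ x⟫ = (∫ x, P₂ x) + ∫ x, P₄ x := by
      rw [← integral_add iP₂ iP₄]
      refine integral_congr_ae (ae_of_all _ fun x => ?_)
      beta_reduce
      rw [hgradψ x]
      simp only [hP₂, hP₄, inner_add_right, inner_smul_right]
      ring
    rw [hsplit] at hz
    linarith
  -- the left-hand side is `∫ (P₁ - P₂ + 2P₃)`
  have eL : ∫ x, deriv H (F x) * ((Δ F) x - fderiv ℝ F x (w x) + 2 * radDerivQuot F x) * Θ x ^ 2 =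
      ((∫ x, P₁ x) - ∫ x, P₂ x) + 2 * ∫ x, P₃ x := by
    calc ∫ x, deriv H (F x) * ((Δ F) x - fderiv ℝ F x (w x) + 2 * radDerivQuot F x) * Θ x ^ 2
        = ∫ x, ((P₁ x - P₂ x) + 2 * P₃ x) := by
          refine integral_congr_ae (ae_of_all _ fun x => ?_)
          beta_reduce
          simp only [hP₁, hP₂, hP₃]
          rw [real_inner_comm (gradient F x) (w x), FluidPDE.inner_gradient_left]
          ring
      _ = (∫ x, (P₁ x - P₂ x)) + ∫ x, 2 * P₃ x := integral_add (iP₁.sub iP₂) (iP₃.const_mul 2)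
      _ = ((∫ x, P₁ x) - ∫ x, P₂ x) + 2 * ∫ x, P₃ x := by
          rw [integral_sub iP₁ iP₂, MeasureTheory.integral_const_mul]
  rw [eL, e₁, e₂]
  ring

/-! ### Continuity in time of the slice functionals -/

section Family

variable {W : ℝ → EuclideanSpace ℝ (Fin 3) → EuclideanSpace ℝ (Fin 3)}
  {f : ℝ → EuclideanSpace ℝ (Fin 3) → ℝ} {lo hi : ℝ}

/-- `(t, x) ↦ ∇f(t, ·)(x)` is jointly continuous when `(t, x) ↦ Df(t, ·)(x)` is. -/
theorem continuousOn_gradient_of_fderiv {S : Set (ℝ × EuclideanSpace ℝ (Fin 3))}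
    (h : ContinuousOn (fun p : ℝ × EuclideanSpace ℝ (Fin 3) => fderiv ℝ (f p.1) p.2) S) :
    ContinuousOn (fun p : ℝ × EuclideanSpace ℝ (Fin 3) => gradient (f p.1) p.2) S :=
  (InnerProductSpace.toDual ℝ (EuclideanSpace ℝ (Fin 3))).symm.continuous.comp_continuousOn h

/-- **Continuity in time of the six slice functionals of the energy method for `η`**
(`M = ∫H(f)Θ²`, `G_H = ∫H''(f)|∇f|²Θ²`, `T₁ = ∫H'(f)⟪∇f,∇Θ²⟫`, `P = ∫H(f)|∇Θ|²`,
`T_W = ∫H(f)⟪W,∇Θ²⟫`, `T_a = ∫H'(f) radDerivQuot f Θ²`) on `]lo, hi[`, for a scalar family with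
`f`, `Df`, `radDerivQuot f`, `W` jointly continuous on `]lo, hi[ × ℝ³`, `H ∈ C²`, `Θ ∈ C¹_c`. -/
theorem continuousOn_eta_sliceFunctionals
    (hfc : ContinuousOn (fun p : ℝ × EuclideanSpace ℝ (Fin 3) => f p.1 p.2) (Ioo lo hi ×ˢ univ))
    (hDc : ContinuousOn (fun p : ℝ × EuclideanSpace ℝ (Fin 3) => fderiv ℝ (f p.1) p.2) (Ioo lo hi ×ˢ univ))
    (hqc : ContinuousOn (fun p : ℝ × EuclideanSpace ℝ (Fin 3) => radDerivQuot (f p.1) p.2) (Ioo lo hi ×ˢ univ))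
    (hWc : ContinuousOn (fun p : ℝ × EuclideanSpace ℝ (Fin 3) => W p.1 p.2) (Ioo lo hi ×ˢ univ))
    {H : ℝ → ℝ} (hH : ContDiff ℝ 2 H)
    {Θ : EuclideanSpace ℝ (Fin 3) → ℝ} (hΘ : ContDiff ℝ 1 Θ) (hΘc : HasCompactSupport Θ)
    {M GH T₁ Pf TW Ta : ℝ → ℝ}
    (hM : ∀ s, M s = ∫ x, H (f s x) * Θ x ^ 2)
    (hGH : ∀ s, GH s = ∫ x, deriv (deriv H) (f s x) * ‖gradient (f s) x‖ ^ 2 * Θ x ^ 2)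
    (hT₁ : ∀ s, T₁ s = ∫ x, deriv H (f s x) * ⟪gradient (f s) x, gradient (fun y => Θ y ^ 2) x⟫)
    (hPf : ∀ s, Pf s = ∫ x, H (f s x) * ‖gradient Θ x‖ ^ 2)
    (hTW : ∀ s, TW s = ∫ x, H (f s x) * ⟪W s x, gradient (fun y => Θ y ^ 2) x⟫)
    (hTa : ∀ s, Ta s = ∫ x, deriv H (f s x) * radDerivQuot (f s) x * Θ x ^ 2) :
    ContinuousOn M (Ioo lo hi) ∧ ContinuousOn GH (Ioo lo hi) ∧ ContinuousOn T₁ (Ioo lo hi) ∧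
      ContinuousOn Pf (Ioo lo hi) ∧ ContinuousOn TW (Ioo lo hi) ∧ ContinuousOn Ta (Ioo lo hi) := by
  set K : Set (EuclideanSpace ℝ (Fin 3)) := tsupport Θ with hKdef
  have hK : IsCompact K := hΘc
  have hKW : K ⊆ univ := subset_univ _
  have hΘ0 : ∀ x, x ∉ K → Θ x = 0 := fun x hx => image_eq_zero_of_notMem_tsupport hx
  have hgΘ0 : ∀ x, x ∉ K → gradient (fun y => Θ y ^ 2) x = 0 := fun x hx => gradient_sq_eq_zero_of_notMem hx
  have hgΘ0' : ∀ x, x ∉ K → gradient Θ x = 0 := fun x hx => gradient_eq_zero_of_notMem_tsupport hx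
  have hH' : ContDiff ℝ 1 (deriv H) := by
    have h2' : ContDiff ℝ (1 + 1) H := by rw [one_add_one_eq_two]; exact hH
    exact h2'.deriv'
  have hΘ2 : ContDiff ℝ 1 fun y => Θ y ^ 2 := hΘ.pow 2
  have cHf : ContinuousOn (fun z : ℝ × EuclideanSpace ℝ (Fin 3) => H (f z.1 z.2)) (Ioo lo hi ×ˢ univ) :=
    hH.continuous.comp_continuousOn hfc
  have cH'f : ContinuousOn (fun z : ℝ × EuclideanSpace ℝ (Fin 3) => deriv H (f z.1 z.2)) (Ioo lo hi ×ˢ univ) :=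
    hH'.continuous.comp_continuousOn hfc
  have cH''f : ContinuousOn (fun z : ℝ × EuclideanSpace ℝ (Fin 3) => deriv (deriv H) (f z.1 z.2))
      (Ioo lo hi ×ˢ univ) := (hH'.continuous_deriv le_rfl).comp_continuousOn hfc
  have cgf := continuousOn_gradient_of_fderiv hDc
  have cΘ2 : Continuous fun z : ℝ × EuclideanSpace ℝ (Fin 3) => Θ z.2 ^ 2 := (hΘ.continuous.comp continuous_snd).pow 2
  have cgΘ : Continuous fun z : ℝ × EuclideanSpace ℝ (Fin 3) => gradient Θ z.2 :=
    (continuous_gradient_of_contDiff hΘ).comp continuous_snd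
  have cgΘ2 : Continuous fun z : ℝ × EuclideanSpace ℝ (Fin 3) => gradient (fun y => Θ y ^ 2) z.2 :=
    (continuous_gradient_of_contDiff hΘ2).comp continuous_snd
  refine ⟨?_, ?_, ?_, ?_, ?_, ?_⟩
  · have h := continuousOn_integral_slice_of_eq_zero (I := Ioo lo hi) isOpen_univ hK hKW
      (Φ := fun z : ℝ × EuclideanSpace ℝ (Fin 3) => H (f z.1 z.2) * Θ z.2 ^ 2)
      (cHf.mul cΘ2.continuousOn) (fun s x hx => by simp [hΘ0 x hx])
    exact h.congr fun s _ => hM s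
  · have h := continuousOn_integral_slice_of_eq_zero (I := Ioo lo hi) isOpen_univ hK hKW
      (Φ := fun z : ℝ × EuclideanSpace ℝ (Fin 3) =>
        deriv (deriv H) (f z.1 z.2) * ‖gradient (f z.1) z.2‖ ^ 2 * Θ z.2 ^ 2)
      ((cH''f.mul (cgf.norm.pow 2)).mul cΘ2.continuousOn) (fun s x hx => by simp [hΘ0 x hx])
    exact h.congr fun s _ => hGH s
  · have h := continuousOn_integral_slice_of_eq_zero (I := Ioo lo hi) isOpen_univ hK hKW
      (Φ := fun z : ℝ × EuclideanSpace ℝ (Fin 3) =>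
        deriv H (f z.1 z.2) * ⟪gradient (f z.1) z.2, gradient (fun y => Θ y ^ 2) z.2⟫)
      (cH'f.mul (cgf.inner cgΘ2.continuousOn)) (fun s x hx => by
        show deriv H (f s x) * ⟪gradient (f s) x, gradient (fun y => Θ y ^ 2) x⟫ = 0
        rw [hgΘ0 x hx, inner_zero_right, mul_zero])
    exact h.congr fun s _ => hT₁ s
  · have h := continuousOn_integral_slice_of_eq_zero (I := Ioo lo hi) isOpen_univ hK hKW
      (Φ := fun z : ℝ × EuclideanSpace ℝ (Fin 3) => H (f z.1 z.2) * ‖gradient Θ z.2‖ ^ 2)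
      (cHf.mul (cgΘ.norm.pow 2).continuousOn) (fun s x hx => by simp [hgΘ0' x hx])
    exact h.congr fun s _ => hPf s
  · have h := continuousOn_integral_slice_of_eq_zero (I := Ioo lo hi) isOpen_univ hK hKW
      (Φ := fun z : ℝ × EuclideanSpace ℝ (Fin 3) => H (f z.1 z.2) * ⟪W z.1 z.2, gradient (fun y => Θ y ^ 2) z.2⟫)
      (cHf.mul (hWc.inner cgΘ2.continuousOn)) (fun s x hx => by
        show H (f s x) * ⟪W s x, gradient (fun y => Θ y ^ 2) x⟫ = 0
        rw [hgΘ0 x hx, inner_zero_right, mul_zero])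
    exact h.congr fun s _ => hTW s
  · have h := continuousOn_integral_slice_of_eq_zero (I := Ioo lo hi) isOpen_univ hK hKW
      (Φ := fun z : ℝ × EuclideanSpace ℝ (Fin 3) =>
        deriv H (f z.1 z.2) * radDerivQuot (f z.1) z.2 * Θ z.2 ^ 2)
      ((cH'f.mul hqc).mul cΘ2.continuousOn) (fun s x hx => by simp [hΘ0 x hx])
    exact h.congr fun s _ => hTa s

/-! ### The energy identity integrated in time -/

/-- **The energy identity for `η`, integrated in time** (memo A.2; the `η`-twin of
`Seregin2020.swirl_energy_identity`).  For a scalar family `f` with `C²` slices and a field `W`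
with `C¹` slices on `]lo, hi[`, `W` divergence free on an open `U`, `f` and
`L = Δf − Df[W] + 2 radDerivQuot f` jointly continuous on `]lo, hi[ × ℝ³`, the integrated
equation `f(t,x) − f(s,x) = ∫ₛᵗ L(τ,x) dτ` at the points of `U`, a profile `H ∈ C²`, a cut-off
`Θ ∈ C¹_c` with `tsupport Θ ⊆ U`, a time factor `χ ∈ C¹` and `lo < t₁ ≤ t₂ < hi`:
`∫ (H(f(t₂))χ(t₂) − H(f(t₁))χ(t₁))Θ² = ∫_{t₁}^{t₂} (χ[−∫(H''|∇f|²Θ² + H'⟪∇f,∇Θ²⟫) + ∫H⟪W,∇Θ²⟫ + 2∫H' q_f Θ²] + χ'∫HΘ²) ds`. -/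
theorem eta_energy_identity
    (hf : ∀ τ ∈ Ioo lo hi, ContDiff ℝ 2 (f τ)) (hW : ∀ τ ∈ Ioo lo hi, ContDiff ℝ 1 (W τ))
    {U : Set (EuclideanSpace ℝ (Fin 3))}
    (hdiv : ∀ τ ∈ Ioo lo hi, ∀ x ∈ U, VectorCalculus.divergence (W τ) x = 0)
    (hfc : ContinuousOn (fun p : ℝ × EuclideanSpace ℝ (Fin 3) => f p.1 p.2) (Ioo lo hi ×ˢ univ))
    (hLc : ContinuousOn (fun p : ℝ × EuclideanSpace ℝ (Fin 3) =>
      (Δ (f p.1)) p.2 - fderiv ℝ (f p.1) p.2 (W p.1 p.2) + 2 * radDerivQuot (f p.1) p.2) (Ioo lo hi ×ˢ univ))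
    (heq : ∀ x ∈ U, ∀ s ∈ Ioo lo hi, ∀ t ∈ Ioo lo hi, s ≤ t →
      f t x - f s x = ∫ τ in s..t, ((Δ (f τ)) x - fderiv ℝ (f τ) x (W τ x) + 2 * radDerivQuot (f τ) x))
    {H : ℝ → ℝ} (hH : ContDiff ℝ 2 H)
    {Θ : EuclideanSpace ℝ (Fin 3) → ℝ} (hΘ : ContDiff ℝ 1 Θ) (hΘc : HasCompactSupport Θ)
    (hΘU : tsupport Θ ⊆ U) {χ : ℝ → ℝ} (hχ : ContDiff ℝ 1 χ)
    {t₁ t₂ : ℝ} (h1 : lo < t₁) (h12 : t₁ ≤ t₂) (h2 : t₂ < hi) :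
    ∫ x, (H (f t₂ x) * χ t₂ - H (f t₁ x) * χ t₁) * Θ x ^ 2 =
      ∫ s in t₁..t₂, (χ s *
        (-(∫ x, (deriv (deriv H) (f s x) * ‖gradient (f s) x‖ ^ 2 * Θ x ^ 2 +
            deriv H (f s x) * ⟪gradient (f s) x, gradient (fun y => Θ y ^ 2) x⟫)) +
          (∫ x, H (f s x) * ⟪W s x, gradient (fun y => Θ y ^ 2) x⟫) +
          2 * ∫ x, deriv H (f s x) * radDerivQuot (f s) x * Θ x ^ 2) +
        deriv χ s * ∫ x, H (f s x) * Θ x ^ 2) := by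
  -- notation: the right-hand side of the equation as an opaque space–time function
  obtain ⟨G, hG⟩ : ∃ G : ℝ → EuclideanSpace ℝ (Fin 3) → ℝ, ∀ r x, G r x =
      (Δ (f r)) x - fderiv ℝ (f r) x (W r x) + 2 * radDerivQuot (f r) x := ⟨_, fun _ _ => rfl⟩
  set K : Set (EuclideanSpace ℝ (Fin 3)) := tsupport Θ with hKdef
  have hK : IsCompact K := hΘc
  have hKm : MeasurableSet K := hK.isClosed.measurableSet
  have hIcc : Icc t₁ t₂ ⊆ Ioo lo hi := fun r hr => ⟨lt_of_lt_of_le h1 hr.1, lt_of_le_of_lt hr.2 h2⟩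
  have hΘ0 : ∀ x, x ∉ K → Θ x = 0 := fun x hx => image_eq_zero_of_notMem_tsupport hx
  have hH1 : ContDiff ℝ 1 H := hH.of_le one_le_two
  have hH' : ContDiff ℝ 1 (deriv H) := by
    have h2' : ContDiff ℝ (1 + 1) H := by rw [one_add_one_eq_two]; exact hH
    exact h2'.deriv'
  have cG : ContinuousOn (fun z : ℝ × EuclideanSpace ℝ (Fin 3) => G z.1 z.2) (Ioo lo hi ×ˢ univ) :=
    hLc.congr fun z _ => hG z.1 z.2
  -- (1) the time-integrated equation, for every `x ∈ K`
  have hgn : ∀ᵐ x ∂(volume.restrict K), IntervalIntegrable (fun r => G r x) volume t₁ t₂ ∧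
      ∀ s ∈ Icc t₁ t₂, f s x = f t₁ x + ∫ r in t₁..s, G r x := by
    rw [ae_restrict_iff' hKm]
    refine ae_of_all _ fun x hx => ?_
    have hxU : x ∈ U := hΘU hx
    have hmk : Continuous fun r : ℝ => ((r, x) : ℝ × EuclideanSpace ℝ (Fin 3)) := continuous_id.prodMk continuous_const
    have hGc : ContinuousOn (fun r => G r x) (Ioo lo hi) := by
      refine ContinuousOn.comp (g := fun z : ℝ × EuclideanSpace ℝ (Fin 3) => G z.1 z.2)
        (f := fun r : ℝ => ((r, x) : ℝ × EuclideanSpace ℝ (Fin 3))) cG hmk.continuousOn fun r hr => ?_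
      exact ⟨hr, mem_univ _⟩
    have hsub : uIcc t₁ t₂ ⊆ Ioo lo hi := by
      rw [uIcc_of_le h12]
      exact hIcc
    refine ⟨(hGc.mono hsub).intervalIntegrable, fun s hs => ?_⟩
    have h := heq x hxU t₁ (hIcc (left_mem_Icc.2 h12)) s (hIcc hs) hs.1
    · have e : ∫ r in t₁..s, G r x = ∫ r in t₁..s, ((Δ (f r)) x - fderiv ℝ (f r) x (W r x) +
          2 * radDerivQuot (f r) x) := intervalIntegral.integral_congr fun r _ => hG r x
      rw [e, ← h]
      ring
  -- (2) integrability of the space–time integrand on `(t₁, t₂] × K`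
  have cΦ : ContinuousOn (fun p : ℝ × EuclideanSpace ℝ (Fin 3) =>
      (deriv H (f p.1 p.2) * G p.1 p.2 * χ p.1 + H (f p.1 p.2) * deriv χ p.1) * Θ p.2 ^ 2)
      (Ioo lo hi ×ˢ univ) := by
    have c1 : ContinuousOn (fun z : ℝ × EuclideanSpace ℝ (Fin 3) => deriv H (f z.1 z.2))
        (Ioo lo hi ×ˢ univ) := hH'.continuous.comp_continuousOn hfc
    have c2 : ContinuousOn (fun z : ℝ × EuclideanSpace ℝ (Fin 3) => H (f z.1 z.2))
        (Ioo lo hi ×ˢ univ) := hH.continuous.comp_continuousOn hfc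
    have c3 : Continuous fun z : ℝ × EuclideanSpace ℝ (Fin 3) => χ z.1 := hχ.continuous.comp continuous_fst
    have c4 : Continuous fun z : ℝ × EuclideanSpace ℝ (Fin 3) => deriv χ z.1 :=
      (hχ.continuous_deriv le_rfl).comp continuous_fst
    have c5 : Continuous fun z : ℝ × EuclideanSpace ℝ (Fin 3) => Θ z.2 ^ 2 :=
      (hΘ.continuous.comp continuous_snd).pow 2
    exact (((c1.mul cG).mul c3.continuousOn).add (c2.mul c4.continuousOn)).mul c5.continuousOn
  have hint : Integrable (fun p : ℝ × EuclideanSpace ℝ (Fin 3) =>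
      (deriv H (f p.1 p.2) * G p.1 p.2 * χ p.1 + H (f p.1 p.2) * deriv χ p.1) * Θ p.2 ^ 2)
      ((volume.restrict (Ioc t₁ t₂)).prod (volume.restrict K)) := by
    have hsub : Icc t₁ t₂ ×ˢ K ⊆ Ioo lo hi ×ˢ (univ : Set (EuclideanSpace ℝ (Fin 3))) :=
      prod_mono hIcc (subset_univ _)
    have hcpt : IsCompact (Icc t₁ t₂ ×ˢ K) := isCompact_Icc.prod hK
    have hI := (cΦ.mono hsub).integrableOn_compact hcpt
      (μ := ((volume : Measure ℝ).prod (volume : Measure (EuclideanSpace ℝ (Fin 3)))))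
    have hI' := hI.mono_set (prod_mono Ioc_subset_Icc_self Subset.rfl)
    rw [IntegrableOn, ← Measure.prod_restrict] at hI'
    exact hI'
  -- (3) the integrated chain rule
  have hchain := integral_comp_mul_sub_eq_integral_integral_ae (μ := volume.restrict K)
    (g := fun r x => f r x) (n := G) h12 hgn hH1 hχ (fun x => Θ x ^ 2) hint
  -- (4) remove the restriction to `K`
  have eLHS : ∫ x in K, (H (f t₂ x) * χ t₂ - H (f t₁ x) * χ t₁) * Θ x ^ 2 =
      ∫ x, (H (f t₂ x) * χ t₂ - H (f t₁ x) * χ t₁) * Θ x ^ 2 :=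
    setIntegral_eq_integral_of_forall_compl_eq_zero fun x hx => by simp [hΘ0 x hx]
  have eRHS : ∀ s, ∫ x in K, (deriv H (f s x) * G s x * χ s + H (f s x) * deriv χ s) * Θ x ^ 2 =
      ∫ x, (deriv H (f s x) * G s x * χ s + H (f s x) * deriv χ s) * Θ x ^ 2 := fun s =>
    setIntegral_eq_integral_of_forall_compl_eq_zero fun x hx => by simp [hΘ0 x hx]
  rw [eLHS] at hchain
  simp_rw [eRHS] at hchain
  rw [hchain]
  -- (5) the slice identity, for `s ∈ [t₁, t₂]`
  refine intervalIntegral.integral_congr fun s hs => ?_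
  rw [uIcc_of_le h12] at hs
  have hsI : s ∈ Ioo lo hi := hIcc hs
  have hF2 : ContDiff ℝ 2 (f s) := hf s hsI
  have cF : Continuous (f s) := hF2.continuous
  have cGs : Continuous fun x => G s x := by
    have hmk : Continuous fun x : EuclideanSpace ℝ (Fin 3) => ((s, x) : ℝ × EuclideanSpace ℝ (Fin 3)) :=
      continuous_const.prodMk continuous_id
    have h := cG.comp_continuous hmk fun x => ⟨hsI, mem_univ _⟩
    exact h
  have cΘ2 : Continuous fun y : EuclideanSpace ℝ (Fin 3) => Θ y ^ 2 := hΘ.continuous.pow 2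
  have iA : Integrable fun x => deriv H (f s x) * G s x * Θ x ^ 2 :=
    (((hH'.continuous.comp cF).mul cGs).mul cΘ2).integrable_of_hasCompactSupport
      (HasCompactSupport.intro hK fun x hx => by simp [hΘ0 x hx])
  have iB : Integrable fun x => H (f s x) * Θ x ^ 2 :=
    ((hH.continuous.comp cF).mul cΘ2).integrable_of_hasCompactSupport
      (HasCompactSupport.intro hK fun x hx => by simp [hΘ0 x hx])
  have hsplit : ∫ x, (deriv H (f s x) * G s x * χ s + H (f s x) * deriv χ s) * Θ x ^ 2 =
      χ s * (∫ x, deriv H (f s x) * G s x * Θ x ^ 2) + deriv χ s * ∫ x, H (f s x) * Θ x ^ 2 := by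
    rw [← MeasureTheory.integral_const_mul, ← MeasureTheory.integral_const_mul,
      ← integral_add (iA.const_mul _) (iB.const_mul _)]
    refine integral_congr_ae (ae_of_all _ fun x => ?_)
    beta_reduce
    ring
  rw [hsplit]
  have eA : ∫ x, deriv H (f s x) * G s x * Θ x ^ 2 =
      ∫ x, deriv H (f s x) * ((Δ (f s)) x - fderiv ℝ (f s) x (W s x) + 2 * radDerivQuot (f s) x) * Θ x ^ 2 :=
    integral_congr_ae (ae_of_all _ fun x => by beta_reduce; rw [hG s x])
  rw [eA, eta_energy_slice_identity hF2 (hW s hsI) (hdiv s hsI) hH hΘ hΘc hΘU]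

end Family

end

end Summit.NavierStokesRegularity.NavierStokesRegularity.Theorems.SwirlFreeBudget
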